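/-
Copyright (c) 2026 the pub-hodgecm-mathlib formalisation cell (harness21).  Prover seat hodgecm-mathlib-K2Liu-p02 (g7), Track B «K2-LIT» ∕ hLiu418
#184♮, socket #41 open surface (u-0c) `K2LiuSiegelEisensteinMiddleTermPackageInstance` (LEAD F0P6-plan (g14) BATCH #49 (4)), file I4 letter: the ROW SECTION
`γ : ℙ¹(L) → GL₂(L)` in BOTH currencies at once.  THEOREMS ONLY (no `def`, no `instance`, no notation, no named-fact hypothesis, no `sorry`).
-/
import Summits.HodgeConjecture.HodgeConjecture.Theorems.K2LiuSiegelMiddleCellLeviCriterion   -- ★ α2d `exists_rowSection`, `row_ne_zero`, `exists_gl_row_eq`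
import HarnessLib

/-!
# Crux `HLiu418`, Road Φ, organ G5-a ∕ (u-0c) file I4, letter: ONE row section `γ : ℙ(L²) → GL₂(L)` serving ★ α3-2 AND ★ (β0-4)′

Cell `hodgecm-mathlib`, crux item hLiu418 = `stmt-HodgeConjecture-24832`; squad K2 ∕ K2Liu, prover K2Liu-p02 (g7); count-neutral helper.
Namespace `Summit.HodgeConjecture.HodgeConjecture.Cruxes.HLiu418.K2LiuMiddleTermRowSection`.

The middle cell of the constant term is summed over `ℙ¹(L)` through a section `γ` of `GL₂(L) → ℙ(L²)`, `g ↦ [g₁]` (second row).  ★ α3-2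
`K2LiuConstantTermMiddleCellGL2.middle_cell_eq_tsum` takes it as `hγ : ∀ p, Projectivization.mk L ((γ p) 1) _ = p`; ★ (β0-4)∕(β0-4)′
`exists_middle_package_of_faces'` (through ★ junction `middle_eq_sum_mirabolicEisenstein`, `e₀ := Pi.single 1 1`) takes THE SAME `γ` as
`hγ : ∀ p, ∃ c : L, c ≠ 0 ∧ Pi.single 1 1 ᵥ* (γ p) = c • p.rep`.  (u-0c)'s assembly needs one `γ` with both: **`exists_rowSection₂`** (★ α2d `exists_rowSection` +
`Pi.single 1 1 ᵥ* M = M 1` + `Projectivization.mk_eq_mk_iff'`).  [KudlaRallis1994, §2 (2.10)–(2.12); MoeglinWaldspurger1995, II.1.7.]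

HONEST LABEL.  Count-neutral helper: `HC_CM` is proved only modulo the 7 printed citations (2 remaining named inputs: hLiu418 = `stmt-HodgeConjecture-24832`,
h413 = `stmt-HodgeConjecture-24833`) until rung 0 closes; closes no socket by itself.
-/

set_option autoImplicit false
set_option linter.dupNamespace false -- the mandated namespace repeats `HodgeConjecture.HodgeConjecture`

namespace Summit.HodgeConjecture.HodgeConjecture.Cruxes.HLiu418.K2LiuMiddleTermRowSection

open Summit.HodgeConjecture.HodgeConjecture.Cruxes.HLiu418.K2LiuSiegelMiddleCellLeviCriterion
open scoped Matrix

variable {K : Type*} [Field K]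

/-- `Pi.single 1 1 ᵥ* M` is the second row of `M`. [folklore] -/
theorem single_one_vecMul (M : Matrix (Fin 2) (Fin 2) K) : Pi.single (1 : Fin 2) (1 : K) ᵥ* M = M 1 := by
  funext j
  simp [Matrix.vecMul, dotProduct, Fin.sum_univ_two]

/-- the row condition in the `Projectivization.mk` currency gives the `vecMul` currency: if `[(γ p)₁] = p` then `e₁ ᵥ* γ p = c • p.rep` for some `c ≠ 0`.
[cite: KudlaRallis1994, §2 (2.10)–(2.12)] -/
theorem exists_smul_rep_of_mk_row_eq (γ : Projectivization K (Fin 2 → K) → GL (Fin 2) K)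
    (hγ : ∀ p, Projectivization.mk K ((γ p : Matrix (Fin 2) (Fin 2) K) 1) (row_ne_zero (γ p) 1) = p)
    (p : Projectivization K (Fin 2 → K)) :
    ∃ c : K, c ≠ 0 ∧ Pi.single (1 : Fin 2) (1 : K) ᵥ* (γ p : Matrix (Fin 2) (Fin 2) K) = c • p.rep := by
  have h : Projectivization.mk K ((γ p : Matrix (Fin 2) (Fin 2) K) 1) (row_ne_zero (γ p) 1) = Projectivization.mk K p.rep p.rep_nonzero :=
    (hγ p).trans (Projectivization.mk_rep p).symm
  rw [Projectivization.mk_eq_mk_iff' K _ _ (row_ne_zero (γ p) 1) p.rep_nonzero] at h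
  obtain ⟨a, ha⟩ := h
  -- `ha : a • p.rep = (γ p) 1`
  have ha0 : a ≠ 0 := by
    rintro rfl
    exact row_ne_zero (γ p) 1 (by rw [← ha, zero_smul])
  exact ⟨a, ha0, by rw [single_one_vecMul, ← ha]⟩

/-- **ONE ROW SECTION IN BOTH CURRENCIES**: there is `γ : ℙ(L²) → GL₂(L)` with `[(γ p)₁] = p` (★ α3-2's `hγ`) AND `e₁ ᵥ* γ p = c_p • p.rep`, `c_p ≠ 0`
((β0-4)′'s `hγ`), for every `p`. [cite: KudlaRallis1994, §2 (2.10)–(2.12)] [cite: MoeglinWaldspurger1995, II.1.7] -/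
theorem exists_rowSection₂ :
    ∃ γ : Projectivization K (Fin 2 → K) → GL (Fin 2) K,
      (∀ p, Projectivization.mk K ((γ p : Matrix (Fin 2) (Fin 2) K) 1) (row_ne_zero (γ p) 1) = p) ∧
      (∀ p, ∃ c : K, c ≠ 0 ∧ Pi.single (1 : Fin 2) (1 : K) ᵥ* (γ p : Matrix (Fin 2) (Fin 2) K) = c • p.rep) := by
  obtain ⟨γ, hγ⟩ := exists_rowSection (K := K)
  exact ⟨γ, hγ, exists_smul_rep_of_mk_row_eq γ hγ⟩

end Summit.HodgeConjecture.HodgeConjecture.Cruxes.HLiu418.K2LiuMiddleTermRowSection
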